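import Summits.QuantumFields.YangMills.Theorems.BalabanUVNodesN12NearFlatFederbushFibreChart
import Literature.MathematicalPhysics.QuantumFieldTheory.Balaban1983to89.B14Eq213DetSet
import Literature.MathematicalPhysics.QuantumFieldTheory.Balaban1983to89.B15Prop1Carrier

/-!
# BalabanUVNodes ∕ N12 — THE FEDERBUSH FIBRE LETTER AT THE DETERMINING SET OF RECORD `𝐁 := 𝐁_k(Z) = Bj M₁ Z k`: the dictionary hypothesis `hcons` of the
# prequel (`…N12NearFlatFederbushFibreChart`) — «the region's `(e₀, e_ν)`-plaquette bonds are level-`k` constrained bonds» — READ at r11∕r12's determining set of the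
# (2.12) problem of record: its level-`k` member is `Γ_k = Ω_k(Z)^{(k)}` (the k-th MAXIMAL DOMAIN of `Z`, NOT `Z`), so `hcons` follows from the ONE geometric letter
# «the region's plaquettes lie in `plaqsInside (pts k (maxDomT M₁ Z k))`» (print's placement (1.73) p. 192 of `Λ` deep inside `Z`); and the `hm` binder of the
# near-flat one-sided (1.7) skeleton at `𝐁_k(Z)` with that letter in place of `hcons`

Cell `pub-ymgap` (HUMAN RULINGS D-0062 ∕ D-0149), width seat `pub-ymgap-dag-n12-w4` g2 (U2c lane); WORD of the N12 lane owner dag-n12-c g17 on ASK-3 = (β) (bus 2026-08-28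
04:00Z: «the record dictionary `hcons`∕`hy` at `𝐁 := Bj ν.M₁ (Z i) (k i)` … is on the critical path of the :395 knit … take it»).  Key K1⁷ `stmt-QuantumFields-20542`,
`--kind proof --supports … --as helper`; count-neutral; THEOREMS ONLY (0 `def`, 0 `sorry`, 0 `instance`).  CONSUMED BY NAME, nothing restated: r11's
`B14.Eq213DetSet.Bj` ∕ `Bj_apply` ∕ `maxDomT` (p. 256 (2.13)), r12's `B15DeterminingSets.gammaRegion_self` ∕ `bondsOf` ∕ `pts`, n12-c's `B15Prop1Carrier.plaqsInside`, this
seat's `N12NearFlatFederbushFibreChart.hm_federbush_of_fderiv_msChart_one_eq` (p603788).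

LOCATED READING (R1) (bus, this seat, 04:10Z).  `(Bj M₁ Z k) k = pts k (gammaRegion (maxDomT M₁ Z) k k) = pts k (maxDomT M₁ Z k)` — the top member of `𝐁_k(Z)` is
`Ω_k(Z)^{(k)}`, [Balaban1988Convergent] (2.2) «Γ_k = Ω_k^{(k)}» with `{Ω_n}` the maximal sequence (2.13) of `Z`.  Hence the N12 endpoint's `hZ : boxPlaqs (lo−1)(hi+1) ⊆
plaqsInside (pts k Z)` is NOT the letter that makes the window's bonds LEVEL-`k` constrained; the letter is the inclusion in `Ω_k(Z)` — DISPLAYED below as `hΩk` (WORD of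
dag-n12-c g17, 04:09Z: «AGREED AS A LETTER … a third cube-geometry letter of the same family as n12-w3's (L)∕(C), S-sized for the knit: at the record it is print's placement
(1.73) p.192»; its correction of this seat's rationale recorded: level-`k` bonds of `Λ` in `Z ∖ Ω_k(Z)` are constrained at LOWER levels, so without `hΩk` only THIS level-`k`
route to `hm` fails, not (1.77)'s non-degeneracy).

CONTENTS.
§1 `Bj_top_eq` (`(Bj M₁ Z k) k = pts k (maxDomT M₁ Z k)`), `mem_bondsOf_Bj_top_iff`, `mem_bondsOf_Bj_top_of_src_mem` (a bond whose source is a `k`-point of `Ω_k(Z)` is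
   constrained at level `k`).
§2 ★ `hcons_of_plaqsInside_maxDomT` — for a region `S_k` of sites whose `(e₀, e_ν)`-plaquettes (all `ν`) have their four corners in `pts k (maxDomT M₁ Z k)`, the four
   bonds `⟨s,e₀⟩, ⟨s+e₀,e_ν⟩, ⟨s+e_ν,e₀⟩, ⟨s,e_ν⟩` are in `bondsOf ((Bj M₁ Z k) k)` — the prequel's `hcons` at `𝐁 := Bj M₁ Z k`.
§3 ★★ `hm_federbush_atBj_of_fderiv_msChart_one_eq` — the skeleton's `hm` binder at the determining set of record:
   `∀ w′, fderiv ℝ (msChart F 2 K k (Bj M₁ Z k) (M˙1) 1) 0 w′ = y → ((L^d)^k∕(L²L²)^k)·circ(X) ≤ D²(A∘expChart 1)(0)(w′,w′)`, hypotheses = the prequel's minus `hcons`,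
   plus `hΩk`; `hy` stays displayed (and, per LOCATED READING (R2) of the same bus line, holds at the record for the Ad-TWISTED slice vector — the knit's business).

HONEST FRAMING.  Set ∕ bond bookkeeping over r11∕r12's definitions; `hΩk` and `hy` DISPLAYED; nothing of Bałaban's asserted; N12 NOT discharged; K1⁷ NOT closed;
count-neutral (typed 28∕28 · discharged 5∕27 unmoved); one finite 𝕋⁴ programme at fixed ε — R4 closes the conditional rung `BalabanLadder.UV` only; the YM mass gap
(Clay) is NOT proved by any of this.  No `sorry`, no `def`, no `instance`, no `notation`.
-/

noncomputable section

open scoped BigOperators Matrix.Norms.L2Operator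
open Finset

namespace Summit.QuantumFields.YangMills.BalabanUVNodes.N12NearFlatFederbushFibreRecord

open Literature.MathematicalPhysics.QuantumFieldTheory.Balaban1983to89
open Literature.MathematicalPhysics.QuantumLattice (quatMatrix)
open T4Continuum (T4Family)
open T4HaarSU2ExpChart (imQuat)
open T4AdjointCovarianceUnitary (lieSU)
open B15DeterminingSets GaugeField
open B14.Eq213DetSet (Bj Bj_apply maxDomT)
open B15Prop1Carrier (plaqsInside mem_plaqsInside_iff)
open B15Prop1SliceCoordinates (GaugeSlice ιA)
open T4AxialGaugeSmallField (castSite)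
open B6TreeGaugePoincare (curl)
open B16Eq18Proof (box)
open LatticeFieldCalculus (runSite)
open BlockAveragingEMLLinearised (linAvg)
open Node00
open Summit.QuantumFields.YangMills.BalabanUVNodes.N12NearFlatFederbushFibreChart (hm_federbush_of_fderiv_msChart_one_eq)

/-! ## §1  The top member of `𝐁_k(Z)` is `Ω_k(Z)^{(k)}` -/

section Top

variable {P : Params} {M₁ k : ℕ}

/-- **`Γ_k = Ω_k(Z)^{(k)}`**: the level-`k` member of the determining set of record `𝐁_k(Z) = Bj M₁ Z k` is the set of `k`-points of the k-th maximal domain `Ω_k(Z)` of `Z`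
(NOT of `Z`). [cite: Balaban1988Convergent, (2.2) p.255, (2.13) pp.256–257; Balaban1989LargeFieldI, (1.14) p.179, (1.74) p.192] -/
theorem Bj_top_eq (Z : Set (Site P 0)) : Bj M₁ Z k k = pts k (maxDomT M₁ Z k) := by
  rw [Bj_apply, gammaRegion_self]

/-- A `k`-bond is constrained at the top level of `𝐁_k(Z)` iff one of its endpoints is a `k`-point of `Ω_k(Z)`. [cite: Balaban1988Convergent, (2.2) p.255, (2.10) p.256] -/
theorem mem_bondsOf_Bj_top_iff (Z : Set (Site P 0)) (b : PBond P k) :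
    b ∈ bondsOf (Bj M₁ Z k k) ↔ b.src ∈ pts k (maxDomT M₁ Z k) ∨ b.tgt ∈ pts k (maxDomT M₁ Z k) := by
  rw [Bj_top_eq]
  rfl

/-- A `k`-bond whose SOURCE is a `k`-point of `Ω_k(Z)` is constrained at the top level of `𝐁_k(Z)`. [cite: Balaban1988Convergent, (2.10) p.256 (bookkeeping)] -/
theorem mem_bondsOf_Bj_top_of_src_mem (Z : Set (Site P 0)) {b : PBond P k} (hb : b.src ∈ pts k (maxDomT M₁ Z k)) :
    b ∈ bondsOf (Bj M₁ Z k k) :=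
  (mem_bondsOf_Bj_top_iff Z b).2 (Or.inl hb)

end Top

/-! ## §2  The region antecedent `hcons` at `𝐁_k(Z)` from the placement `region ⊂ Ω_k(Z)` -/

section Cons

variable {P : Params} {M₁ k : ℕ}

/-- ★ **`hcons` AT THE DETERMINING SET OF RECORD**: if every `(e₀, e_ν)`-plaquette at the sites of the region `S_k` lies INSIDE `Ω_k(Z)^{(k)}` (all four corners — n12-c's
`plaqsInside`; print's placement (1.73) of `Λ` deep inside `Z`), then its four bonds `⟨s,e₀⟩, ⟨s+e₀,e_ν⟩, ⟨s+e_ν,e₀⟩, ⟨s,e_ν⟩` are level-`k` constrained bonds of `𝐁_k(Z)` (each has its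
source among the corners `s, s+e₀, s+e_ν`). [cite: Balaban1989LargeFieldI, Prop. 1 p.194, (1.74)–(1.75) pp.192–193; Balaban1988Convergent, (2.2) p.255, (2.13) pp.256–257] -/
theorem hcons_of_plaqsInside_maxDomT (h0 : 0 < P.d) (Z : Set (Site P 0)) (Sk : Finset (Site P k))
    (hΩk : ∀ (ν : Fin P.d), ∀ s ∈ Sk, s ∈ pts k (maxDomT M₁ Z k) ∧ s.shift ⟨0, h0⟩ ∈ pts k (maxDomT M₁ Z k) ∧ s.shift ν ∈ pts k (maxDomT M₁ Z k)) :
    ∀ (ν : Fin P.d), ∀ s ∈ Sk, (⟨s, ⟨0, h0⟩⟩ : PBond P k) ∈ bondsOf (Bj M₁ Z k k) ∧ (⟨s.shift ⟨0, h0⟩, ν⟩ : PBond P k) ∈ bondsOf (Bj M₁ Z k k) ∧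
      (⟨s.shift ν, ⟨0, h0⟩⟩ : PBond P k) ∈ bondsOf (Bj M₁ Z k k) ∧ (⟨s, ν⟩ : PBond P k) ∈ bondsOf (Bj M₁ Z k k) := by
  intro ν s hs
  obtain ⟨h1, h2, h3⟩ := hΩk ν s hs
  exact ⟨mem_bondsOf_Bj_top_of_src_mem Z h1, mem_bondsOf_Bj_top_of_src_mem Z h2, mem_bondsOf_Bj_top_of_src_mem Z h3,
    mem_bondsOf_Bj_top_of_src_mem Z h1⟩

/-- The same through an ENCLOSING SET: if a set `X ⊆ Ω_k(Z)^{(k)}` contains, for every `s ∈ S_k` and every `ν`, the three corner sites `s`, `s + e₀`, `s + e_ν` (e.g. `X` = the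
`k`-points of a box of sites around `Λ` known to lie in `Ω_k(Z)`), then `hcons` holds at `𝐁_k(Z)`. [cite: Balaban1989LargeFieldI, (1.75) p.193 (bookkeeping)] -/
theorem hcons_of_subset_maxDomT (h0 : 0 < P.d) (Z : Set (Site P 0)) (Sk : Finset (Site P k)) {X : Set (Site P k)}
    (hX : X ⊆ pts k (maxDomT M₁ Z k)) (hSk : ∀ (ν : Fin P.d), ∀ s ∈ Sk, s ∈ X ∧ s.shift ⟨0, h0⟩ ∈ X ∧ s.shift ν ∈ X) :
    ∀ (ν : Fin P.d), ∀ s ∈ Sk, (⟨s, ⟨0, h0⟩⟩ : PBond P k) ∈ bondsOf (Bj M₁ Z k k) ∧ (⟨s.shift ⟨0, h0⟩, ν⟩ : PBond P k) ∈ bondsOf (Bj M₁ Z k k) ∧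
      (⟨s.shift ν, ⟨0, h0⟩⟩ : PBond P k) ∈ bondsOf (Bj M₁ Z k k) ∧ (⟨s, ν⟩ : PBond P k) ∈ bondsOf (Bj M₁ Z k k) :=
  hcons_of_plaqsInside_maxDomT h0 Z Sk fun ν s hs =>
    ⟨hX (hSk ν s hs).1, hX (hSk ν s hs).2.1, hX (hSk ν s hs).2.2⟩

end Cons

/-! ## §3  The `hm` binder at `𝐁_k(Z)` -/

section Binder

variable {F : T4Family} {K k M₁ : ℕ} [DecidableEq (PBond (F.P K) k)]

/-- ★★ **THE `hm` BINDER OF THE NEAR-FLAT SKELETON AT THE DETERMINING SET OF RECORD `𝐁_k(Z)`**: as the prequel's `hm_federbush_of_fderiv_msChart_one_eq` with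
`𝐁 := Bj M₁ Z k`, the dictionary hypothesis `hcons` REPLACED by the placement letter `hΩk` («the region's `(e₀,e_ν)`-plaquette corners `s, s+e₀, s+e_ν` are `k`-points of
`Ω_k(Z)`»); `hy` (the datum velocity carries `φ(ιA X)` at the level-`k` constrained bonds) stays displayed.  Conclusion:
`∀ w′, fderiv ℝ (msChart F 2 K k (Bj M₁ Z k) (M˙1) 1) 0 w′ = y → ((L^d)^k∕(L²L²)^k)·circ(X) ≤ D²(A∘expChart 1)(0)(w′,w′)`.
[cite: Balaban1989LargeFieldII, (1.7) pp.357–358; Balaban1989LargeFieldI, (1.74) p.192, Prop. 1 p.194; Balaban1988Convergent, (2.13) pp.256–257] -/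
theorem hm_federbush_atBj_of_fderiv_msChart_one_eq (h0 : 0 < (F.P K).d) (hk : k ≤ (F.P K).m + (F.P K).K)
    (Q : (i : ℕ) → (PBond (F.P K) 0 → Matrix (Fin 2) (Fin 2) ℂ) → PBond (F.P K) i → Matrix (Fin 2) (Fin 2) ℂ)
    (hQ0 : ∀ Y, Q 0 Y = Y) (hQs : ∀ (i : ℕ) (Y : PBond (F.P K) 0 → Matrix (Fin 2) (Fin 2) ℂ) (c : PBond (F.P K) (i + 1)), Q (i + 1) Y c = linAvg (Q i Y) c)
    (Z : Set (Site (F.P K) 0)) {S : Set (Site (F.P K) k)} {T : Finset (PBond (F.P K) k)} (X : GaugeSlice S T (EuclideanSpace ℝ (Fin 3)))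
    {m : Fin (F.P K).d → ℕ} (lo : Fin (F.P K).d → ℤ) (hm : ∀ κ, (m κ : ℤ) ≤ (F.P K).sitesPerDir k)
    (Sset : (i : ℕ) → Finset (Site (F.P K) i)) (hwin : ∀ z ∈ box m lo, (castSite z : Site (F.P K) k) ∈ Sset k)
    (hS : ∀ (ν : Fin (F.P K).d), (⟨0, h0⟩ : Fin (F.P K).d) ≠ ν → ∀ i, i < k → ∀ y ∈ Sset (i + 1), ∀ (r : Fin (F.P K).d → Fin (F.P K).L) (s t : ℕ),
      s < (F.P K).L → t < (F.P K).L → runSite (runSite (Site.blockSite y r) ⟨0, h0⟩ s) ν t ∈ Sset i)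
    {φ : EuclideanSpace ℝ (Fin 3) →ₗ[ℝ] lieSU (Fin 2)} (hφ : ∀ v, ((φ v : lieSU (Fin 2)) : Matrix (Fin 2) (Fin 2) ℂ) = quatMatrix (imQuat v))
    (hΩk : ∀ (ν : Fin (F.P K).d), ∀ s ∈ Sset k, s ∈ pts k (maxDomT M₁ Z k) ∧ s.shift ⟨0, h0⟩ ∈ pts k (maxDomT M₁ Z k) ∧ s.shift ν ∈ pts k (maxDomT M₁ Z k))
    {y : Fin (constrCard (Bj M₁ Z k) k) → lieSU (Fin 2)}
    (hy : ∀ (b : PBond (F.P K) k) (hb : b ∈ bondsOf (Bj M₁ Z k k)), y (constrEnum (Bj M₁ Z k) k ⟨Fin.last k, ⟨b, hb⟩⟩) = φ (ιA S T X b)) :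
    ∀ w' : PBond (F.P K) 0 → lieSU (Fin 2),
      fderiv ℝ (msChart F 2 K k (Bj M₁ Z k) (avgFamily (avOfRecord F 2 K) (1 : GaugeField (F.P K) 0 (SU 2))) (1 : GaugeField (F.P K) 0 (SU 2))) 0 w' = y →
      (((F.P K).L : ℝ) ^ (F.P K).d) ^ k / ((((F.P K).L : ℝ)) ^ 2 * ((F.P K).L : ℝ) ^ 2) ^ k *
          ∑ z ∈ box m lo, ∑ μ : Fin (F.P K).d, ∑ a : Fin 3, curl (fun b => ιA S T X (⟨castSite b.1, b.2⟩ : PBond (F.P K) k) a) z ⟨0, h0⟩ μ ^ 2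
        ≤ fderiv ℝ (fun Y => fderiv ℝ (fun Y : PBond (F.P K) 0 → lieSU (Fin 2) => wilsonAction4 (expChart (1 : GaugeField (F.P K) 0 (SU 2)) Y)) Y) 0 w' w' :=
  hm_federbush_of_fderiv_msChart_one_eq h0 hk Q hQ0 hQs (Bj M₁ Z k) X lo hm Sset hwin hS hφ (hcons_of_plaqsInside_maxDomT h0 Z (Sset k) hΩk) hy

end Binder

end Summit.QuantumFields.YangMills.BalabanUVNodes.N12NearFlatFederbushFibreRecord

end
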